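/-
Copyright: statement-level skeleton of a published paper (lit-balaban cell, Phase-2 proof seat p19, gen 7). No claims beyond
what the kernel checks below.
-/
import Mathlib
import Literature.MathematicalPhysics.QuantumFieldTheory.Balaban1983to89.B3Eq318Members

/-!
# B3 — T. Bałaban, *(Higgs)₂,₃ quantum fields in a finite volume. III. Renormalization*, CMP **88** (1983) 411–445
[Balaban1983Higgs3] — p. 438 [PDF 28]: the PRIMITIVELY DIVERGENT SCALAR SELF-ENERGY GRAPHS **(3.18)**, pictures 4–6 (two vertices
(1.8)_{2,0}; (1.8)_{3,0} with an A′-tadpole joined to (1.8)_{1,0}; and the fifth picture as printed), and their generalized graphs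
**(3.20)** as WORKED MEMBERS of the family of generalized graphs of Proposition 2.2 (`famK`) — part 2 of `B3Eq318Members`

statement-level skeleton of published theorems with citation tags; proofs where landed; nothing here is a claim about
the Yang–Mills mass gap

PDF held: `paper:balaban1983-higgs-2-3-quantum-fields-finite-volume` (journal page = PDF page + 410); pp. 413, 423–424, 428,
435, 438 [PDF 3, 13–14, 18, 25, 28] read in the OCR text and on the ×2 renders `…/1983-cmp88-higgs23-III-p003-x2.png`,
`…-p028-x2.png`.

CITATION HEADER (lean-in-tree rule).  Part of the lit-balaban TYPED SKELETON (HOME `run/shared/lean/pub/lit-balaban/`), PHASE 2,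
seat p19 generation 7 (file 3; files 1–2 `B3TwoVertexBlocks`, `B3Eq318Members`).  WHAT IS REPRODUCED: rows **B3.Eq3.18-3.20**
(located members: the pictures 4, 5, 6 of (3.18) and their generalized graphs (3.20)) and **B3.Prop2.2** (further worked members)
of `HOME/lit-balaban-r15/ROWS-B3.md` (fold owner r15, referee ref-4).  CONSUMES BY NAME, nothing re-proved: `B3TwoVertexBlocks`
(`properPos_of_twoVertex`, `degZero_of_twoVertex`, `wholePos_of_twoVertex`, `linesConnect_twoVertex`), `B3Eq318Members`
(`κ318`, `κ318_nonneg`, `sum_κ318`, `κ318_mem_menu`, `zero_mem_menu`, `not_is24K_of_properPos`), p18's `B3FreeLine` family and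
`B3Eq320PositiveSubgraphs.posSubgraphsExcept24_of_degZero`/`posSubgraphsExcept24_of_properPos`/`posSubgraphs_of_properPos`,
`B3Eq322Member.paramsK322`, p18 g3's readings `B3Sect3Graphs318.g318d/g318e/g318f` with `g318d_deg`/`g318e_deg`/`g318f_deg`
(GAPS G-B3-06 for the fifth picture).  The conventions, the printed text and the honest scope are those of `B3Eq318Members`
(module docstring there): count data with `d = 3`, `L = 2`, `δ₁ = 1`, vertices `x = 0`, `x′ = 1`, η-powers `etaCount − d`, the
differentiations of the (1.8) vertices acting on the internal φ′-line as `diffOn`, `+α = ½` on the line `0`; members of the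
ABSTRACT-amplitude family `famK`; `d = 3` only.

WHAT IS PROVED.  `graph318d` (two (1.8)_{2,0}: φ′-line of dimension `−3`, two A′-lines), `graph318f` ((1.8)_{3,0} with the
A′-tadpole (line `2`, a loop at `x`), A′-line, φ′-line of dimension `−3`, to (1.8)_{1,0}), `graph318e` (the fifth picture AS
PRINTED: the differentiation of `x` on its external leg, φ′-line of dimension `−2`): line dimensions, whole degree `W = 0` (`= 1`
for `e`) agreeing with p18 g3's catalogue degrees at `d = 3`, primitive divergence along every ordering (`properPos_graph318x`, by
the two-vertex criterion; the tadpole block `{x}` has degree `e_x + a_{tadpole} = 2 − 1 = 1`), `degZero_graph318x`; members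
`memberK318d`, `memberK318f` (κ = `κ318`) with **`posSubgraphsExcept24_memberK318x`** (instance of `posSubgraphsExcept24_of_degZero`),
`posSubgraphs_…`, `not_is24_…`, **`ineq133_memberK318x`**; and `memberK318e` with `κ ≡ 0` — a CONVERGENT graph meeting the printed
hypothesis outright (`posSubgraphsExcept24_memberK318e`, whole degree `1 > 0`).  D-0026: definitions with bodies (three count data,
three members) + theorems; no named facts, no `sorry`; standard axioms.  Unit `lit-balaban-p19-g7`
(literature-prover-lit-balaban-p19-g7-0), HOME `run/shared/lean/pub/lit-balaban/`, 2026-08-21.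
-/

open Finset

namespace Literature.MathematicalPhysics.QuantumFieldTheory.Balaban1983to89.B3Eq318MembersPart2

open B3Ineq215 B3Ineq213 B3Sect2FirstEstimate B3Prop1 B3FreeLine B3Eq322Member B3Eq320PositiveSubgraphs B3TwoVertexBlocks
open B3Eq318Members

/-! ## §1 The fourth picture: two vertices (1.8)_{2,0}, the φ′-line through both differentiated legs -/

/-- **(3.18), fourth picture** as a count datum: `x = 0`, `x′ = 1` of type (1.8)_{2,0} (η-power `1`), both differentiations acting
on the φ′-line `0` (`x → x′`); lines `1, 2` = the A′-lines `x → x′`. [cite: Balaban1983Higgs3, (3.18) p.438] -/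
noncomputable def graph318d : Counts (Fin 2) 3 where
  src := fun _ => 0
  tgt := fun _ => 1
  touches := fun v => ⟨0, by fin_cases v <;> simp⟩
  diffOn := fun _ l => if l = 0 then 1 else 0
  vecLegAvg := fun _ _ => 0
  etaPow := fun _ => 1
  d := 3
  L := 2
  δ₁ := 1
  d_pos := by norm_num
  two_le_L := le_rfl
  δ₁_pos := one_pos

/-- Every line joins `x` to `x′`. [cite: Balaban1983Higgs3, (3.18) p.438] -/
theorem orient_graph318d : ∀ l, graph318d.src l ≠ graph318d.tgt l → graph318d.src l = 0 := fun _ _ => rfl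

/-- **(2.14)**: the φ′-line has dimension `−(d−2) − 2 = −3` (two differentiations), the A′-lines `−1`. [cite: Balaban1983Higgs3, (2.14) p.427] -/
theorem lineDimQ_graph318d (l : Fin 3) : lineDimQ graph318d l = if l = 0 then -3 else -1 := by
  unfold lineDimQ legExpQ Counts.legsOn
  simp only [graph318d, Fin.sum_univ_two]
  fin_cases l <;> simp <;> norm_num

/-- **p. 438 "degrees equal to 0"**: `W = 3 + 1 + 1 − 3 − 1 − 1 = 0`. [cite: Balaban1983Higgs3, (3.18) p.438] -/
theorem wholeDeg_graph318d :
    (graph318d.d : ℚ) + graph318d.etaPow 0 + graph318d.etaPow 1 + ∑ l, lineDimQ graph318d l = 0 := by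
  simp only [lineDimQ_graph318d, Fin.sum_univ_three]
  simp [graph318d]
  norm_num

/-- The two degree counts of the tree agree: `W` = p18 g3's catalogue degree `6 − 2d` of the fourth picture at `d = 3`.
[cite: Balaban1983Higgs3, (3.18) p.438] -/
theorem wholeDeg_graph318d_eq_deg (nbar : ℕ) (hn : 2 ≤ nbar) :
    (graph318d.d : ℚ) + graph318d.etaPow 0 + graph318d.etaPow 1 + ∑ l, lineDimQ graph318d l =
      (B3Sect3Graphs318.g318d nbar hn).deg 3 := by
  rw [wholeDeg_graph318d, B3Sect3Graphs318.g318d_deg]; norm_num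

/-- **Primitive divergence**: along every ordering every proper non-trivial block has positive degree (`5 + a_{σ0} ∈ {2, 4}`
after one line, `∈ {1, 3}` after two). [cite: Balaban1983Higgs3, (3.18) p.438] -/
theorem properPos_graph318d (σ : Equiv.Perm (Fin 3)) (i : ℕ) (b : Fin 2) (hb : b ∈ (relabelCounts graph318d σ).toModel.reps i)
    (hn : (relabelCounts graph318d σ).toModel.Nontriv i b) (hne : (relabelCounts graph318d σ).toModel.before i b ≠ univ) :
    0 < degQ (relabelCounts graph318d σ) i b :=
  properPos_of_twoVertex graph318d orient_graph318d (fun l => by rw [lineDimQ_graph318d]; split_ifs <;> norm_num)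
    wholeDeg_graph318d.ge
    (by
      rintro v ⟨l, hs, ht⟩
      exact absurd (hs.trans ht.symm) (by simp [graph318d]))
    σ i b hb hn hne

/-- … while the whole graph has degree `0` along every ordering. [cite: Balaban1983Higgs3, (3.18) p.438] -/
theorem degZero_graph318d (σ : Equiv.Perm (Fin 3)) (i : ℕ) (b : Fin 2)
    (hw : (relabelCounts graph318d σ).toModel.before i b = univ) : degQ (relabelCounts graph318d σ) i b = 0 :=
  degZero_of_twoVertex graph318d orient_graph318d wholeDeg_graph318d σ i b hw

/-- **The generalized graph (3.20) of the fourth picture is a member of the family of Proposition 2.2** at every size bound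
`mb ≥ 3`. [cite: Balaban1983Higgs3, Prop. 2.2 p.428] -/
noncomputable def memberK318d (Cmax CD : ℝ) {mb : ℕ} (h : 3 ≤ mb) : CGraphK (paramsK322 Cmax CD) mb where
  n := 2
  m := 3
  m_le := h
  G := graph318d
  d_eq := rfl
  L_eq := rfl
  δ₁_eq := rfl
  conn := linesConnect_twoVertex graph318d ⟨0, rfl, rfl⟩
  κ := κ318
  κ_mem := κ318_mem_menu Cmax CD

/-- **(3.20) for the fourth picture: the PRINTED hypothesis of Propositions 2.1/2.2 holds for its generalized graph, all
orderings, through positivity.** [cite: Balaban1983Higgs3, (3.20) p.438] -/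
theorem posSubgraphsExcept24_memberK318d (Cmax CD : ℝ) {mb : ℕ} (h : 3 ≤ mb) (D : DatumK (paramsK322 Cmax CD)) :
    PosSubgraphsExcept24 (expansionK (paramsK322 Cmax CD) mb D) (memberK318d Cmax CD h) :=
  posSubgraphsExcept24_of_degZero D _ κ318_nonneg (by change (0 : ℚ) < ∑ l, κ318 l; rw [sum_κ318]; norm_num)
    (fun σ i b hb hn hne => properPos_graph318d σ i b hb hn hne) (fun σ i b hw => degZero_graph318d σ i b hw)

/-- Every connected subgraph along every ordering has positive generalized degree. [cite: Balaban1983Higgs3, (3.20) p.438] -/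
theorem posSubgraphs_memberK318d (Cmax CD : ℝ) {mb : ℕ} (h : 3 ≤ mb) (D : DatumK (paramsK322 Cmax CD)) :
    ∀ H : (expansionK (paramsK322 Cmax CD) mb D).Sub (memberK318d Cmax CD h),
      0 < (expansionK (paramsK322 Cmax CD) mb D).subDeg (memberK318d Cmax CD h) H :=
  posSubgraphs_of_properPos D _ κ318_nonneg (fun σ i b hb hn hne => properPos_graph318d σ i b hb hn hne)
    (fun σ i b hw => by
      change 0 < degQ (relabelCounts graph318d σ) i b + ∑ l, κ318 l
      rw [degZero_graph318d σ i b hw, sum_κ318]; norm_num)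

/-- No block of the member is an exceptional (2.4)-block. [cite: Balaban1983Higgs3, (2.4) p.424] -/
theorem not_is24_memberK318d (Cmax CD : ℝ) {mb : ℕ} (h : 3 ≤ mb) (D : DatumK (paramsK322 Cmax CD)) :
    ∀ H : (expansionK (paramsK322 Cmax CD) mb D).Sub (memberK318d Cmax CD h),
      ¬ (expansionK (paramsK322 Cmax CD) mb D).Is24 (memberK318d Cmax CD h) H := by
  rintro ⟨σ, i, b, hb, hn⟩
  exact not_is24K_of_properPos graph318d κ318 (by norm_num) (fun σ i b hb hn hne => properPos_graph318d σ i b hb hn hne) σ i b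

/-- (1.33) for the generalized graph of the fourth picture, as asserted by `prop21_freeLines`. [cite: Balaban1983Higgs3, Prop. 2.2 p.428] -/
theorem ineq133_memberK318d (Cmax CD : ℝ) (mbar : ℕ → ℕ) (nbar : ℕ) (h : 3 ≤ mbar nbar) (α₀ : ℝ) (h0 : 0 < α₀)
    (h1 : α₀ < 1) :
    ∃ δ₀ C : ℝ, 0 < δ₀ ∧ 0 < C ∧ ∀ D : DatumK (paramsK322 Cmax CD),
      Ineq133At (famK (paramsK322 Cmax CD) mbar nbar D).toExpansion
        ((famK (paramsK322 Cmax CD) mbar nbar D).single (memberK318d Cmax CD h)) α₀ δ₀ C := by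
  obtain ⟨δ₀, hδ₀, H⟩ := prop21_freeLines (paramsK322 Cmax CD) mbar
  obtain ⟨C, hC, HC⟩ := H α₀ h0 h1 nbar
  exact ⟨δ₀, C, hδ₀, hC, fun D => HC D _ (posSubgraphsExcept24_memberK318d Cmax CD h D)⟩

/-! ## §2 The sixth picture: (1.8)_{3,0} with an A′-tadpole, the A′-line and the φ′-line through both differentiated legs to (1.8)_{1,0} -/

/-- **(3.18), sixth picture** as a count datum: `x = 0` of type (1.8)_{3,0} (η-power `3 − 1 = 2`), `x′ = 1` of type (1.8)_{1,0}
(η-power `0`); line `0` = the φ′-line `x → x′` carrying BOTH differentiations, line `1` = the A′-line `x → x′`, line `2` = the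
A′-tadpole at `x` (`x → x`). [cite: Balaban1983Higgs3, (3.18) p.438] -/
noncomputable def graph318f : Counts (Fin 2) 3 where
  src := fun _ => 0
  tgt := fun l => if l = 2 then 0 else 1
  touches := fun v => ⟨0, by fin_cases v <;> simp⟩
  diffOn := fun _ l => if l = 0 then 1 else 0
  vecLegAvg := fun _ _ => 0
  etaPow := fun v => if v = 0 then 2 else 0
  d := 3
  L := 2
  δ₁ := 1
  d_pos := by norm_num
  two_le_L := le_rfl
  δ₁_pos := one_pos

/-- Every line joins `x` to `x′` or is a loop (all lines start at `x`). [cite: Balaban1983Higgs3, (3.18) p.438] -/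
theorem orient_graph318f : ∀ l, graph318f.src l ≠ graph318f.tgt l → graph318f.src l = 0 := fun _ _ => rfl

/-- **(2.14)**: the φ′-line has dimension `−(d−2) − 2 = −3`, the A′-line and the A′-tadpole `−1` each. [cite: Balaban1983Higgs3, (2.14) p.427] -/
theorem lineDimQ_graph318f (l : Fin 3) : lineDimQ graph318f l = if l = 0 then -3 else -1 := by
  unfold lineDimQ legExpQ Counts.legsOn
  simp only [graph318f, Fin.sum_univ_two]
  fin_cases l <;> simp <;> norm_num

/-- **p. 438 "degrees equal to 0"**: `W = 3 + 2 + 0 − 3 − 1 − 1 = 0`. [cite: Balaban1983Higgs3, (3.18) p.438] -/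
theorem wholeDeg_graph318f :
    (graph318f.d : ℚ) + graph318f.etaPow 0 + graph318f.etaPow 1 + ∑ l, lineDimQ graph318f l = 0 := by
  simp only [lineDimQ_graph318f, Fin.sum_univ_three]
  simp [graph318f]
  norm_num

/-- The two degree counts of the tree agree: `W` = p18 g3's catalogue degree `6 − 2d` of the sixth picture at `d = 3`.
[cite: Balaban1983Higgs3, (3.18) p.438] -/
theorem wholeDeg_graph318f_eq_deg (nbar : ℕ) (hn : 3 ≤ nbar) :
    (graph318f.d : ℚ) + graph318f.etaPow 0 + graph318f.etaPow 1 + ∑ l, lineDimQ graph318f l =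
      (B3Sect3Graphs318.g318f nbar hn).deg 3 := by
  rw [wholeDeg_graph318f, B3Sect3Graphs318.g318f_deg]; norm_num

/-- The loops of the sixth picture: only the tadpole (line `2`), at `x = 0`. [cite: Balaban1983Higgs3, (3.18) p.438] -/
theorem loops_graph318f :
    (univ.filter fun l : Fin 3 => graph318f.src l = 0 ∧ graph318f.tgt l = 0) = {2} := by
  ext l
  fin_cases l <;> simp [graph318f]

/-- **Primitive divergence**: along every ordering every proper non-trivial block has positive degree — the tadpole block `{x}`
has degree `e_x + a_{tadpole} = 2 − 1 = 1`, the blocks after joining `x` to `x′` have degrees `5 − Σ(present a_l) ∈ {1, …, 4}`.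
[cite: Balaban1983Higgs3, (3.18) p.438] -/
theorem properPos_graph318f (σ : Equiv.Perm (Fin 3)) (i : ℕ) (b : Fin 2) (hb : b ∈ (relabelCounts graph318f σ).toModel.reps i)
    (hn : (relabelCounts graph318f σ).toModel.Nontriv i b) (hne : (relabelCounts graph318f σ).toModel.before i b ≠ univ) :
    0 < degQ (relabelCounts graph318f σ) i b :=
  properPos_of_twoVertex graph318f orient_graph318f (fun l => by rw [lineDimQ_graph318f]; split_ifs <;> norm_num)
    wholeDeg_graph318f.ge
    (by
      rintro v ⟨l, hs, ht⟩
      have hv : v = 0 := hs.symm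
      subst hv
      rw [loops_graph318f, sum_singleton, lineDimQ_graph318f]
      simp [graph318f])
    σ i b hb hn hne

/-- … while the whole graph has degree `0` along every ordering. [cite: Balaban1983Higgs3, (3.18) p.438] -/
theorem degZero_graph318f (σ : Equiv.Perm (Fin 3)) (i : ℕ) (b : Fin 2)
    (hw : (relabelCounts graph318f σ).toModel.before i b = univ) : degQ (relabelCounts graph318f σ) i b = 0 :=
  degZero_of_twoVertex graph318f orient_graph318f wholeDeg_graph318f σ i b hw

/-- **The generalized graph (3.20) of the sixth picture is a member of the family of Proposition 2.2** at every size bound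
`mb ≥ 3`. [cite: Balaban1983Higgs3, Prop. 2.2 p.428] -/
noncomputable def memberK318f (Cmax CD : ℝ) {mb : ℕ} (h : 3 ≤ mb) : CGraphK (paramsK322 Cmax CD) mb where
  n := 2
  m := 3
  m_le := h
  G := graph318f
  d_eq := rfl
  L_eq := rfl
  δ₁_eq := rfl
  conn := linesConnect_twoVertex graph318f ⟨0, rfl, by simp [graph318f]⟩
  κ := κ318
  κ_mem := κ318_mem_menu Cmax CD

/-- **(3.20) for the sixth picture: the PRINTED hypothesis of Propositions 2.1/2.2 holds for its generalized graph, all orderings,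
through positivity.** [cite: Balaban1983Higgs3, (3.20) p.438] -/
theorem posSubgraphsExcept24_memberK318f (Cmax CD : ℝ) {mb : ℕ} (h : 3 ≤ mb) (D : DatumK (paramsK322 Cmax CD)) :
    PosSubgraphsExcept24 (expansionK (paramsK322 Cmax CD) mb D) (memberK318f Cmax CD h) :=
  posSubgraphsExcept24_of_degZero D _ κ318_nonneg (by change (0 : ℚ) < ∑ l, κ318 l; rw [sum_κ318]; norm_num)
    (fun σ i b hb hn hne => properPos_graph318f σ i b hb hn hne) (fun σ i b hw => degZero_graph318f σ i b hw)

/-- Every connected subgraph along every ordering has positive generalized degree. [cite: Balaban1983Higgs3, (3.20) p.438] -/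
theorem posSubgraphs_memberK318f (Cmax CD : ℝ) {mb : ℕ} (h : 3 ≤ mb) (D : DatumK (paramsK322 Cmax CD)) :
    ∀ H : (expansionK (paramsK322 Cmax CD) mb D).Sub (memberK318f Cmax CD h),
      0 < (expansionK (paramsK322 Cmax CD) mb D).subDeg (memberK318f Cmax CD h) H :=
  posSubgraphs_of_properPos D _ κ318_nonneg (fun σ i b hb hn hne => properPos_graph318f σ i b hb hn hne)
    (fun σ i b hw => by
      change 0 < degQ (relabelCounts graph318f σ) i b + ∑ l, κ318 l
      rw [degZero_graph318f σ i b hw, sum_κ318]; norm_num)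

/-- No block of the member is an exceptional (2.4)-block. [cite: Balaban1983Higgs3, (2.4) p.424] -/
theorem not_is24_memberK318f (Cmax CD : ℝ) {mb : ℕ} (h : 3 ≤ mb) (D : DatumK (paramsK322 Cmax CD)) :
    ∀ H : (expansionK (paramsK322 Cmax CD) mb D).Sub (memberK318f Cmax CD h),
      ¬ (expansionK (paramsK322 Cmax CD) mb D).Is24 (memberK318f Cmax CD h) H := by
  rintro ⟨σ, i, b, hb, hn⟩
  exact not_is24K_of_properPos graph318f κ318 (by norm_num) (fun σ i b hb hn hne => properPos_graph318f σ i b hb hn hne) σ i b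

/-- (1.33) for the generalized graph of the sixth picture, as asserted by `prop21_freeLines`. [cite: Balaban1983Higgs3, Prop. 2.2 p.428] -/
theorem ineq133_memberK318f (Cmax CD : ℝ) (mbar : ℕ → ℕ) (nbar : ℕ) (h : 3 ≤ mbar nbar) (α₀ : ℝ) (h0 : 0 < α₀)
    (h1 : α₀ < 1) :
    ∃ δ₀ C : ℝ, 0 < δ₀ ∧ 0 < C ∧ ∀ D : DatumK (paramsK322 Cmax CD),
      Ineq133At (famK (paramsK322 Cmax CD) mbar nbar D).toExpansion
        ((famK (paramsK322 Cmax CD) mbar nbar D).single (memberK318f Cmax CD h)) α₀ δ₀ C := by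
  obtain ⟨δ₀, hδ₀, H⟩ := prop21_freeLines (paramsK322 Cmax CD) mbar
  obtain ⟨C, hC, HC⟩ := H α₀ h0 h1 nbar
  exact ⟨δ₀, C, hδ₀, hC, fun D => HC D _ (posSubgraphsExcept24_memberK318f Cmax CD h D)⟩

/-! ## §3 The fifth picture AS PRINTED: a convergent graph (p18 g3, GAPS G-B3-06) -/

/-- **(3.18), fifth picture AS PRINTED** as a count datum: as the sixth, except that only the vertex `x′ = 1` ((1.8)_{1,0}) carries
its differentiation on the φ′-line `0`; the differentiation of `x = 0` ((1.8)_{3,0}, η-power `2`) is on its EXTERNAL leg (the only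
catalogue reading of the picture, p18 g3 `B3Sect3Graphs318.g318e`). [cite: Balaban1983Higgs3, (3.18) p.438] -/
noncomputable def graph318e : Counts (Fin 2) 3 where
  src := fun _ => 0
  tgt := fun l => if l = 2 then 0 else 1
  touches := fun v => ⟨0, by fin_cases v <;> simp⟩
  diffOn := fun v l => if v = 1 ∧ l = 0 then 1 else 0
  vecLegAvg := fun _ _ => 0
  etaPow := fun v => if v = 0 then 2 else 0
  d := 3
  L := 2
  δ₁ := 1
  d_pos := by norm_num
  two_le_L := le_rfl
  δ₁_pos := one_pos

/-- Every line joins `x` to `x′` or is a loop. [cite: Balaban1983Higgs3, (3.18) p.438] -/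
theorem orient_graph318e : ∀ l, graph318e.src l ≠ graph318e.tgt l → graph318e.src l = 0 := fun _ _ => rfl

/-- **(2.14)**: the φ′-line has dimension `−(d−2) − 1 = −2` (one differentiation), the A′-line and the tadpole `−1`.
[cite: Balaban1983Higgs3, (2.14) p.427] -/
theorem lineDimQ_graph318e (l : Fin 3) : lineDimQ graph318e l = if l = 0 then -2 else -1 := by
  unfold lineDimQ legExpQ Counts.legsOn
  simp only [graph318e, Fin.sum_univ_two]
  fin_cases l <;> simp <;> norm_num

/-- **The fifth picture as printed has degree `W = 3 + 2 + 0 − 2 − 1 − 1 = 1 > 0`** (p18 g3: *"D = 7 − 2d = 1 in d = 3, i.e. is NOT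
divergent"*). [cite: Balaban1983Higgs3, (3.18) p.438] -/
theorem wholeDeg_graph318e :
    (graph318e.d : ℚ) + graph318e.etaPow 0 + graph318e.etaPow 1 + ∑ l, lineDimQ graph318e l = 1 := by
  simp only [lineDimQ_graph318e, Fin.sum_univ_three]
  simp [graph318e]
  norm_num

/-- The two degree counts of the tree agree: `W` = p18 g3's catalogue degree `7 − 2d` of the fifth picture as printed at `d = 3`.
[cite: Balaban1983Higgs3, (3.18) p.438] -/
theorem wholeDeg_graph318e_eq_deg (nbar : ℕ) (hn : 3 ≤ nbar) :
    (graph318e.d : ℚ) + graph318e.etaPow 0 + graph318e.etaPow 1 + ∑ l, lineDimQ graph318e l =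
      (B3Sect3Graphs318.g318e nbar hn).deg 3 := by
  rw [wholeDeg_graph318e, B3Sect3Graphs318.g318e_deg]; norm_num

/-- The loops of the fifth picture: only the tadpole (line `2`), at `x = 0`. [cite: Balaban1983Higgs3, (3.18) p.438] -/
theorem loops_graph318e :
    (univ.filter fun l : Fin 3 => graph318e.src l = 0 ∧ graph318e.tgt l = 0) = {2} := by
  ext l
  fin_cases l <;> simp [graph318e]

/-- Along every ordering every proper non-trivial block has positive degree. [cite: Balaban1983Higgs3, (3.18) p.438] -/
theorem properPos_graph318e (σ : Equiv.Perm (Fin 3)) (i : ℕ) (b : Fin 2) (hb : b ∈ (relabelCounts graph318e σ).toModel.reps i)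
    (hn : (relabelCounts graph318e σ).toModel.Nontriv i b) (hne : (relabelCounts graph318e σ).toModel.before i b ≠ univ) :
    0 < degQ (relabelCounts graph318e σ) i b :=
  properPos_of_twoVertex graph318e orient_graph318e (fun l => by rw [lineDimQ_graph318e]; split_ifs <;> norm_num)
    (by rw [wholeDeg_graph318e]; norm_num)
    (by
      rintro v ⟨l, hs, ht⟩
      have hv : v = 0 := hs.symm
      subst hv
      rw [loops_graph318e, sum_singleton, lineDimQ_graph318e]
      simp [graph318e])
    σ i b hb hn hne

/-- … and so has the whole graph (degree `1`): EVERY connected subgraph along every ordering has positive degree, with the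
standard line dimensions. [cite: Balaban1983Higgs3, (3.18) p.438] -/
theorem wholePos_graph318e (σ : Equiv.Perm (Fin 3)) (i : ℕ) (b : Fin 2)
    (hw : (relabelCounts graph318e σ).toModel.before i b = univ) :
    0 < degQ (relabelCounts graph318e σ) i b + ∑ _l : Fin 3, (0 : ℚ) :=
  wholePos_of_twoVertex graph318e orient_graph318e (fun _ => 0) (by rw [wholeDeg_graph318e]; simp) σ i b hw

/-- The fifth picture as printed, with its STANDARD line dimensions (`κ ≡ 0`), as a member of the family of Proposition 2.2 at every
size bound `mb ≥ 3`. [cite: Balaban1983Higgs3, Prop. 2.2 p.428] -/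
noncomputable def memberK318e (Cmax CD : ℝ) {mb : ℕ} (h : 3 ≤ mb) : CGraphK (paramsK322 Cmax CD) mb where
  n := 2
  m := 3
  m_le := h
  G := graph318e
  d_eq := rfl
  L_eq := rfl
  δ₁_eq := rfl
  conn := linesConnect_twoVertex graph318e ⟨0, rfl, by simp [graph318e]⟩
  κ := fun _ => 0
  κ_mem := fun _ => zero_mem_menu Cmax CD

/-- **The fifth picture as printed is a CONVERGENT graph: the printed hypothesis of Propositions 2.1/2.2 holds for it outright**
(no subtraction (3.19) needed; instance of `posSubgraphsExcept24_of_properPos`). [cite: Balaban1983Higgs3, Prop. 2.2 p.428] -/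
theorem posSubgraphsExcept24_memberK318e (Cmax CD : ℝ) {mb : ℕ} (h : 3 ≤ mb) (D : DatumK (paramsK322 Cmax CD)) :
    PosSubgraphsExcept24 (expansionK (paramsK322 Cmax CD) mb D) (memberK318e Cmax CD h) :=
  posSubgraphsExcept24_of_properPos D _ (fun _ => le_rfl) (fun σ i b hb hn hne => properPos_graph318e σ i b hb hn hne)
    (fun σ i b hw => wholePos_graph318e σ i b hw)

/-- Every connected subgraph along every ordering has positive degree. [cite: Balaban1983Higgs3, Prop. 2.2 p.428] -/
theorem posSubgraphs_memberK318e (Cmax CD : ℝ) {mb : ℕ} (h : 3 ≤ mb) (D : DatumK (paramsK322 Cmax CD)) :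
    ∀ H : (expansionK (paramsK322 Cmax CD) mb D).Sub (memberK318e Cmax CD h),
      0 < (expansionK (paramsK322 Cmax CD) mb D).subDeg (memberK318e Cmax CD h) H :=
  posSubgraphs_of_properPos D _ (fun _ => le_rfl) (fun σ i b hb hn hne => properPos_graph318e σ i b hb hn hne)
    (fun σ i b hw => wholePos_graph318e σ i b hw)

/-- No block of the member is an exceptional (2.4)-block. [cite: Balaban1983Higgs3, (2.4) p.424] -/
theorem not_is24_memberK318e (Cmax CD : ℝ) {mb : ℕ} (h : 3 ≤ mb) (D : DatumK (paramsK322 Cmax CD)) :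
    ∀ H : (expansionK (paramsK322 Cmax CD) mb D).Sub (memberK318e Cmax CD h),
      ¬ (expansionK (paramsK322 Cmax CD) mb D).Is24 (memberK318e Cmax CD h) H := by
  rintro ⟨σ, i, b, hb, hn⟩
  exact not_is24K_of_properPos graph318e (fun _ => 0) (by norm_num)
    (fun σ i b hb hn hne => properPos_graph318e σ i b hb hn hne) σ i b

/-- (1.33) for the fifth picture as printed, as asserted by `prop21_freeLines`. [cite: Balaban1983Higgs3, Prop. 2.2 p.428] -/
theorem ineq133_memberK318e (Cmax CD : ℝ) (mbar : ℕ → ℕ) (nbar : ℕ) (h : 3 ≤ mbar nbar) (α₀ : ℝ) (h0 : 0 < α₀)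
    (h1 : α₀ < 1) :
    ∃ δ₀ C : ℝ, 0 < δ₀ ∧ 0 < C ∧ ∀ D : DatumK (paramsK322 Cmax CD),
      Ineq133At (famK (paramsK322 Cmax CD) mbar nbar D).toExpansion
        ((famK (paramsK322 Cmax CD) mbar nbar D).single (memberK318e Cmax CD h)) α₀ δ₀ C := by
  obtain ⟨δ₀, hδ₀, H⟩ := prop21_freeLines (paramsK322 Cmax CD) mbar
  obtain ⟨C, hC, HC⟩ := H α₀ h0 h1 nbar
  exact ⟨δ₀, C, hδ₀, hC, fun D => HC D _ (posSubgraphsExcept24_memberK318e Cmax CD h D)⟩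

end Literature.MathematicalPhysics.QuantumFieldTheory.Balaban1983to89.B3Eq318MembersPart2
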